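import Mathlib.Analysis.InnerProductSpace.Calculus
import Mathlib.Analysis.InnerProductSpace.Laplacian
import Mathlib.Analysis.InnerProductSpace.Projection.Reflection
import Mathlib.Analysis.Calculus.FDeriv.Mul
import Mathlib.MeasureTheory.Measure.Haar.InnerProductSpace
import Mathlib.MeasureTheory.Integral.Bochner.Basic
import HarnessLib

/-!
# Radial calculus: derivatives of `z ↦ g(‖z‖²)` and second moments of radial weights

Analysis/FluidPDE support file (kernel calculus for the Newtonian potential and the Riesz-type
pressure kernel of `FluidPDE/NormalisedPressure`; serves the discharge of the inputs F1–F3 of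
Tao's pressure-normalisation lemma, `FluidPDE/NormalisedPressureProofs`).

Let `E` be a real inner product space. For a profile `g : ℝ → ℝ` and `G(z) = g(‖z‖²)`:

* `hasFDerivAt_comp_norm_sq`: `DG(z) = 2 g'(‖z‖²) ⟨z, ·⟩`;
* `hasFDerivAt_fderiv_comp_norm_sq_apply`, `fderiv_fderiv_comp_norm_sq_apply`:
  `∂_c ∂_a G(z) = 4 g''(‖z‖²) ⟨z,a⟩⟨z,c⟩ + 2 g'(‖z‖²) ⟨a,c⟩`;
* `laplacian_comp_norm_sq`: `ΔG(z) = 4 g''(‖z‖²) ‖z‖² + 2 d g'(‖z‖²)` (`d = dim E`).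

The hypotheses are pointwise (`g` differentiable with derivative `g₁` on an open set of radii
containing `‖z‖²`, `g₁` differentiable at `‖z‖²`), so that the lemmas apply both to the singular
Newtonian profile `σ ↦ σ^{-1/2}` away from the origin and to its smooth regularisations.

* `integral_radial_mul_inner_mul_inner`: for a radial weight `ρ` on a finite-dimensional `E`
  with `ρ(z)‖z‖²` integrable, `∫ ρ(z) ⟨z,a⟩⟨z,c⟩ dz = d⁻¹ (∫ ρ(z)‖z‖² dz) ⟨a,c⟩` (the second-moment
  tensor of a radial weight is isotropic): invariance under linear isometries, transitivity of
  reflections on spheres (Mathlib `reflection_sub`), polarisation and the trace.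

## References

* D. Gilbarg, N. S. Trudinger, *Elliptic partial differential equations of second order*
  (2001), (2.12)–(2.14) (derivatives of the fundamental solution), (4.9)–(4.10).
* E. M. Stein, *Singular integrals and differentiability properties of functions* (1970),
  Ch. III §1 (the Riesz kernels `Ω(x)/|x|ⁿ` and their cancellation).
-/

noncomputable section

open MeasureTheory Set Filter Topology InnerProductSpace Function
open scoped RealInnerProductSpace Laplacian

namespace Literature.Analysis.FluidPDE

variable {E : Type*} [NormedAddCommGroup E] [InnerProductSpace ℝ E]

/-! ### Derivatives of `z ↦ g (‖z‖ ^ 2)` -/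

/-- Over `ℝ` the inner-product map `innerSL` is a genuine continuous bilinear map; evaluating
its linear (non-semilinear) coercion. [folklore] -/
@[simp] theorem innerSL_real_coe_apply_apply (a v : E) :
    ((innerSL ℝ : E →L[ℝ] E →L[ℝ] ℝ) a) v = ⟪a, v⟫ := rfl

/-- **First derivative of a radial function**: if `g` has derivative `g₁` at `‖z‖²` then
`z ↦ g(‖z‖²)` has derivative `2 g₁ ⟨z, ·⟩` at `z`. [folklore] -/
theorem hasFDerivAt_comp_norm_sq {g : ℝ → ℝ} {g₁ : ℝ} {z : E} (hg : HasDerivAt g g₁ (‖z‖ ^ 2)) :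
    HasFDerivAt (fun w : E => g (‖w‖ ^ 2)) ((2 * g₁) • (innerSL ℝ z : E →L[ℝ] ℝ)) z := by
  have h := hg.comp_hasFDerivAt z (hasStrictFDerivAt_norm_sq z).hasFDerivAt
  refine (h.congr_fderiv ?_)
  ext v
  simp
  ring

/-- `∂ₐ (g(‖·‖²))(z) = 2 g₁ ⟨z, a⟩`. [folklore] -/
theorem fderiv_comp_norm_sq_apply {g : ℝ → ℝ} {g₁ : ℝ} {z : E} (hg : HasDerivAt g g₁ (‖z‖ ^ 2))
    (a : E) : fderiv ℝ (fun w : E => g (‖w‖ ^ 2)) z a = 2 * g₁ * ⟪z, a⟫ := by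
  rw [(hasFDerivAt_comp_norm_sq hg).fderiv]
  simp

/-- The operator-valued derivative `z ↦ D(g(‖·‖²))(z) = 2 g₁(‖z‖²) ⟨z, ·⟩` is itself
differentiable at `z` when `g` is differentiable with derivative `g₁` on an open set of radii
containing `‖z‖²` and `g₁` is differentiable at `‖z‖²`. [folklore] -/
theorem hasFDerivAt_fderiv_comp_norm_sq {g g₁ : ℝ → ℝ} {g₂ : ℝ} {U : Set ℝ} (hU : IsOpen U)
    (hg : ∀ σ ∈ U, HasDerivAt g (g₁ σ) σ) {z : E} (hz : ‖z‖ ^ 2 ∈ U)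
    (hg₁ : HasDerivAt g₁ g₂ (‖z‖ ^ 2)) :
    HasFDerivAt (fderiv ℝ (fun w : E => g (‖w‖ ^ 2)))
      ((2 * g₁ (‖z‖ ^ 2)) • (innerSL ℝ : E →L[ℝ] E →L[ℝ] ℝ) +
        ((2 * (2 * g₂)) • (innerSL ℝ z : E →L[ℝ] ℝ)).smulRight (innerSL ℝ z : E →L[ℝ] ℝ)) z := by
  -- near `z` the derivative is `w ↦ (2 g₁(‖w‖²)) • ⟨w, ·⟩`
  have hV : {w : E | ‖w‖ ^ 2 ∈ U} ∈ 𝓝 z :=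
    (hU.preimage (continuous_norm.pow 2)).mem_nhds hz
  have heq : (fun w : E => (2 * g₁ (‖w‖ ^ 2)) • (innerSL ℝ w : E →L[ℝ] ℝ)) =ᶠ[𝓝 z]
      fderiv ℝ (fun w : E => g (‖w‖ ^ 2)) := by
    filter_upwards [hV] with w hw
    exact ((hasFDerivAt_comp_norm_sq (hg _ hw)).fderiv).symm
  refine HasFDerivAt.congr_of_eventuallyEq ?_ heq.symm
  have h1 : HasFDerivAt (fun w : E => 2 * g₁ (‖w‖ ^ 2)) ((2 * (2 * g₂)) • (innerSL ℝ z : E →L[ℝ] ℝ))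
      z := by
    have := (hasFDerivAt_comp_norm_sq (g := g₁) hg₁).const_mul 2
    refine this.congr_fderiv ?_
    rw [smul_smul]
  have h2 : HasFDerivAt (fun w : E => (innerSL ℝ w : E →L[ℝ] ℝ)) (innerSL ℝ : E →L[ℝ] E →L[ℝ] ℝ) z :=
    (innerSL ℝ : E →L[ℝ] E →L[ℝ] ℝ).hasFDerivAt
  exact h1.smul h2

/-- **Second directional derivatives of a radial function**: with `g' = g₁` near `‖z‖²` and
`g₁' (‖z‖²) = g₂`, the function `w ↦ ∂ₐ(g(‖·‖²))(w)` has derivative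
`4 g₂ ⟨z,a⟩ ⟨z, ·⟩ + 2 g₁(‖z‖²) ⟨a, ·⟩` at `z`. [folklore] -/
theorem hasFDerivAt_fderiv_comp_norm_sq_apply {g g₁ : ℝ → ℝ} {g₂ : ℝ} {U : Set ℝ} (hU : IsOpen U)
    (hg : ∀ σ ∈ U, HasDerivAt g (g₁ σ) σ) {z : E} (hz : ‖z‖ ^ 2 ∈ U)
    (hg₁ : HasDerivAt g₁ g₂ (‖z‖ ^ 2)) (a : E) :
    HasFDerivAt (fun w : E => fderiv ℝ (fun w : E => g (‖w‖ ^ 2)) w a)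
      ((4 * g₂ * ⟪z, a⟫) • (innerSL ℝ z : E →L[ℝ] ℝ) +
        (2 * g₁ (‖z‖ ^ 2)) • (innerSL ℝ a : E →L[ℝ] ℝ)) z := by
  -- near `z` the directional derivative is `w ↦ 2 g₁(‖w‖²) ⟨w, a⟩`
  have hV : {w : E | ‖w‖ ^ 2 ∈ U} ∈ 𝓝 z :=
    (hU.preimage (continuous_norm.pow 2)).mem_nhds hz
  have heq : (fun w : E => 2 * g₁ (‖w‖ ^ 2) * ⟪w, a⟫) =ᶠ[𝓝 z]
      fun w => fderiv ℝ (fun w : E => g (‖w‖ ^ 2)) w a := by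
    filter_upwards [hV] with w hw
    exact (fderiv_comp_norm_sq_apply (hg _ hw) a).symm
  refine HasFDerivAt.congr_of_eventuallyEq ?_ heq.symm
  have h1 : HasFDerivAt (fun w : E => 2 * g₁ (‖w‖ ^ 2)) ((2 * (2 * g₂)) • (innerSL ℝ z : E →L[ℝ] ℝ))
      z := by
    have := (hasFDerivAt_comp_norm_sq (g := g₁) hg₁).const_mul 2
    refine this.congr_fderiv ?_
    rw [smul_smul]
  have h2 : HasFDerivAt (fun w : E => ⟪w, a⟫) (innerSL ℝ a : E →L[ℝ] ℝ) z := by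
    refine ((innerSL ℝ a : E →L[ℝ] ℝ).hasFDerivAt).congr_of_eventuallyEq
      (Eventually.of_forall fun w => ?_)
    simp only [innerSL_apply_apply]
    exact real_inner_comm a w
  refine (h1.mul h2).congr_fderiv ?_
  ext v
  simp
  ring

/-- `∂_c ∂_a (g(‖·‖²))(z) = 4 g₂ ⟨z,a⟩⟨z,c⟩ + 2 g₁(‖z‖²) ⟨a,c⟩`. [folklore] -/
theorem fderiv_fderiv_comp_norm_sq_apply {g g₁ : ℝ → ℝ} {g₂ : ℝ} {U : Set ℝ} (hU : IsOpen U)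
    (hg : ∀ σ ∈ U, HasDerivAt g (g₁ σ) σ) {z : E} (hz : ‖z‖ ^ 2 ∈ U)
    (hg₁ : HasDerivAt g₁ g₂ (‖z‖ ^ 2)) (a c : E) :
    fderiv ℝ (fun w : E => fderiv ℝ (fun w : E => g (‖w‖ ^ 2)) w a) z c =
      4 * g₂ * ⟪z, a⟫ * ⟪z, c⟫ + 2 * g₁ (‖z‖ ^ 2) * ⟪a, c⟫ := by
  rw [(hasFDerivAt_fderiv_comp_norm_sq_apply hU hg hz hg₁ a).fderiv]
  simp

/-- **Laplacian of a radial function**: `Δ(g(‖·‖²))(z) = 4 g₂ ‖z‖² + 2 d g₁(‖z‖²)`,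
`d = dim E` (Gilbarg–Trudinger, (2.11): `Δ = ∂ᵣᵣ + (n-1) r⁻¹ ∂ᵣ` on radial functions, in the
variable `σ = r²`). [folklore] -/
theorem laplacian_comp_norm_sq [FiniteDimensional ℝ E] {g g₁ : ℝ → ℝ} {g₂ : ℝ} {U : Set ℝ}
    (hU : IsOpen U) (hg : ∀ σ ∈ U, HasDerivAt g (g₁ σ) σ) {z : E} (hz : ‖z‖ ^ 2 ∈ U)
    (hg₁ : HasDerivAt g₁ g₂ (‖z‖ ^ 2)) :
    (Δ (fun w : E => g (‖w‖ ^ 2))) z =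
      4 * g₂ * ‖z‖ ^ 2 + 2 * (Module.finrank ℝ E) * g₁ (‖z‖ ^ 2) := by
  set b := stdOrthonormalBasis ℝ E
  have hD : DifferentiableAt ℝ (fderiv ℝ (fun w : E => g (‖w‖ ^ 2))) z :=
    (hasFDerivAt_fderiv_comp_norm_sq hU hg hz hg₁).differentiableAt
  have h1 : ∀ i, iteratedFDeriv ℝ 2 (fun w : E => g (‖w‖ ^ 2)) z ![b i, b i] =
      4 * g₂ * ⟪z, b i⟫ * ⟪z, b i⟫ + 2 * g₁ (‖z‖ ^ 2) * ⟪b i, b i⟫ := fun i => by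
    rw [iteratedFDeriv_two_apply, ← fderiv_fderiv_comp_norm_sq_apply hU hg hz hg₁ (b i) (b i),
      fderiv_clm_apply hD (differentiableAt_const _)]
    simp
  rw [congrFun (laplacian_eq_iteratedFDeriv_orthonormalBasis (fun w : E => g (‖w‖ ^ 2)) b) z]
  simp_rw [h1, Finset.sum_add_distrib]
  have h2 : ∑ i, ⟪z, b i⟫ * ⟪z, b i⟫ = ‖z‖ ^ 2 := by
    simp_rw [fun i => real_inner_comm (b i) z]
    rw [show ∑ i, ⟪b i, z⟫ * ⟪b i, z⟫ = ∑ i, ⟪z, b i⟫ * ⟪b i, z⟫ from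
      Finset.sum_congr rfl fun i _ => by rw [real_inner_comm], b.sum_inner_mul_inner,
      real_inner_self_eq_norm_sq]
  have h3 : ∑ i, ⟪b i, b i⟫ = (Module.finrank ℝ E : ℝ) := by
    simp_rw [real_inner_self_eq_norm_sq, b.orthonormal.1, one_pow, Finset.sum_const,
      Finset.card_univ, Fintype.card_fin, nsmul_eq_mul, mul_one]
  have h2' : ∑ i, 4 * g₂ * ⟪z, b i⟫ * ⟪z, b i⟫ = 4 * g₂ * ‖z‖ ^ 2 := by
    rw [← h2, Finset.mul_sum]
    exact Finset.sum_congr rfl fun i _ => by ring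
  have h3' : ∑ i, 2 * g₁ (‖z‖ ^ 2) * ⟪b i, b i⟫ = 2 * (Module.finrank ℝ E) * g₁ (‖z‖ ^ 2) := by
    rw [← Finset.mul_sum, h3]
    ring
  rw [h2', h3']

/-! ### Second moments of radial weights -/

section Moments

variable [FiniteDimensional ℝ E] [MeasurableSpace E] [BorelSpace E]

/-- **The second-moment tensor of a radial weight is isotropic**: for a radial `ρ` with
`ρ(z)‖z‖²` integrable, `∫ ρ(z) ⟨z,a⟩⟨z,c⟩ dz = d⁻¹ (∫ ρ(z)‖z‖² dz) ⟨a,c⟩` (`d = dim E`).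
Proof: the left side is a symmetric bilinear form in `(a, c)` invariant under all linear
isometries; reflections act transitively on spheres (`reflection_sub`), so its diagonal is
`λ‖a‖²`; polarise and take the trace. [folklore] -/
theorem integral_radial_mul_inner_mul_inner {ρ : E → ℝ} (hrad : ∀ x y, ‖x‖ = ‖y‖ → ρ x = ρ y)
    (hmeas : AEStronglyMeasurable ρ volume) (hint : Integrable (fun z => ρ z * ‖z‖ ^ 2))
    (a c : E) :
    ∫ z, ρ z * (⟪z, a⟫ * ⟪z, c⟫) =
      (∫ z, ρ z * ‖z‖ ^ 2) / (Module.finrank ℝ E) * ⟪a, c⟫ := by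
  -- the bilinear form and its integrability
  set Q : E → E → ℝ := fun a c => ∫ z, ρ z * (⟪z, a⟫ * ⟪z, c⟫) with hQ
  have hI : ∀ a c, Integrable (fun z => ρ z * (⟪z, a⟫ * ⟪z, c⟫)) (volume : Measure E) := by
    intro a c
    refine Integrable.mono' ((hint.abs).const_mul (‖a‖ * ‖c‖))
      (hmeas.mul ((continuous_id.inner continuous_const).mul
        (continuous_id.inner continuous_const)).aestronglyMeasurable)
      (Eventually.of_forall fun z => ?_)
    rw [Real.norm_eq_abs, abs_mul, abs_mul, abs_mul, abs_of_nonneg (by positivity : 0 ≤ ‖z‖ ^ 2)]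
    calc |ρ z| * (|⟪z, a⟫| * |⟪z, c⟫|) ≤ |ρ z| * ((‖z‖ * ‖a‖) * (‖z‖ * ‖c‖)) := by
          gcongr <;> exact abs_real_inner_le_norm _ _
      _ = ‖a‖ * ‖c‖ * (|ρ z| * ‖z‖ ^ 2) := by ring
  -- bilinearity and symmetry
  have hsymm : ∀ a c, Q a c = Q c a := fun a c => by
    simp only [hQ, mul_comm ⟪_, a⟫]
  have hadd : ∀ a a' c, Q (a + a') c = Q a c + Q a' c := fun a a' c => by
    simp only [hQ]
    rw [← integral_add (hI a c) (hI a' c)]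
    refine integral_congr_ae (Eventually.of_forall fun z => ?_)
    simp only [inner_add_right]
    ring
  have hsmul : ∀ (t : ℝ) a c, Q (t • a) c = t * Q a c := fun t a c => by
    simp only [hQ]
    rw [← integral_const_mul]
    refine integral_congr_ae (Eventually.of_forall fun z => ?_)
    simp only [real_inner_smul_right]
    ring
  -- invariance under linear isometries
  have hinv : ∀ (U : E ≃ₗᵢ[ℝ] E) a c, Q (U a) (U c) = Q a c := fun U a c => by
    simp only [hQ]
    have hmp : MeasurePreserving (U.toMeasurableEquiv) volume volume := U.measurePreserving
    rw [← hmp.integral_comp' (fun z => ρ z * (⟪z, U a⟫ * ⟪z, U c⟫))]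
    refine integral_congr_ae (Eventually.of_forall fun z => ?_)
    simp only [LinearIsometryEquiv.coe_toMeasurableEquiv, LinearIsometryEquiv.inner_map_map,
      hrad (U z) z (U.norm_map z)]
  -- the diagonal depends only on the norm
  have hdiag : ∀ a a' : E, ‖a‖ = ‖a'‖ → Q a a = Q a' a' := fun a a' h => by
    have := hinv (Submodule.reflection (ℝ ∙ (a - a'))ᗮ) a a
    rw [Submodule.reflection_sub h] at this
    exact this.symm
  rcases subsingleton_or_nontrivial E with hE | hE
  · have h0 : ∀ z : E, z = 0 := fun z => Subsingleton.elim z 0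
    simp [h0 a]
  obtain ⟨e, he⟩ : ∃ e : E, ‖e‖ = 1 := exists_norm_eq E zero_le_one
  set lam := Q e e with hlam
  have hdiag' : ∀ a : E, Q a a = ‖a‖ ^ 2 * lam := fun a => by
    rw [hdiag a (‖a‖ • e) (by rw [norm_smul, he, mul_one, Real.norm_eq_abs,
      abs_of_nonneg (norm_nonneg _)]), hsmul, hsymm, hsmul]
    ring
  -- polarisation
  have hpol : ∀ a c : E, Q a c = lam * ⟪a, c⟫ := fun a c => by
    have h1 : Q (a + c) (a + c) = Q a a + 2 * Q a c + Q c c := by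
      rw [hadd, hsymm a (a + c), hsymm c (a + c), hadd, hadd, hsymm c a]
      ring
    rw [hdiag', hdiag', hdiag', norm_add_sq_real] at h1
    linarith
  -- the trace
  set b := stdOrthonormalBasis ℝ E
  have htr : ∑ i, Q (b i) (b i) = ∫ z, ρ z * ‖z‖ ^ 2 := by
    simp only [hQ]
    rw [← integral_finsetSum _ fun i _ => hI (b i) (b i)]
    refine integral_congr_ae (Eventually.of_forall fun z => ?_)
    show ∑ i, ρ z * (⟪z, b i⟫ * ⟪z, b i⟫) = ρ z * ‖z‖ ^ 2
    rw [← Finset.mul_sum]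
    congr 1
    rw [show ∑ i, ⟪z, b i⟫ * ⟪z, b i⟫ = ∑ i, ⟪z, b i⟫ * ⟪b i, z⟫ from
      Finset.sum_congr rfl fun i _ => by rw [real_inner_comm (b i) z], b.sum_inner_mul_inner,
      real_inner_self_eq_norm_sq]
  have htr' : ∑ i, Q (b i) (b i) = lam * (Module.finrank ℝ E) := by
    simp_rw [hpol, real_inner_self_eq_norm_sq, b.orthonormal.1, one_pow, Finset.sum_const,
      Finset.card_univ, Fintype.card_fin, nsmul_eq_mul]
    ring
  have hd : (0 : ℝ) < Module.finrank ℝ E := by exact_mod_cast Module.finrank_pos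
  show Q a c = _
  rw [hpol, ← htr, htr']
  field_simp

end Moments

end Literature.Analysis.FluidPDE

end
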